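import Summits.AtomisticToContinuum.Crystallization.Theorems.FreeSplittingCertificatesStrictSplittingRuleP1CellMoments3

/-!
# `StrictSplittingRule` (stmt-AtomisticToContinuum-12560): EXACT second moments of the P1 cells — `∫_K λ_i² = |K|/10`, `∫_K λ_iλ_j = |K|/20` (P1 interpolant object, part 23)

Route `FreeSplittingCertificates`, crux r3 `StrictSplittingRule` (H12⋆ = `stub_coreJointCoercive`), unit b2b-freesplit-B gen 27.
VALUE = a kernel brick of the demand side of the transfer (HOME FAR-LEMMA-SPEC §17 (e)/(h), §19 (d)): parts 21–22 pinned the second moments of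
the reference pieces only up to Cauchy–Schwarz (`∫_K λ_iλ_j ≤ |K|/16`); the per-site domination lemma beyond the near reach (CERT §28 (1): the
hat distribution of the quarter triangulation has a FIRST MOMENT, `m₁ = Σ_T Σ_j (∫_T λ_qλ_j)(y_j − y_q)`) needs the EXACT values.  They follow
WITHOUT computing any simplex integral, from one integral over the unit CUBE: the six even reference pieces tile the cube with null overlaps
(part 8), the chart coordinate `t = p 0` is, on each piece, the sum of the barycentric coordinates of the vertices with `t = 1` (affine
reproduction), and transporting each piece to the corner simplex `K` (parts 20–22) turns `∫_{[0,1]³} t² = 1/3` into `12α + 16β = 1/3` for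
`α = ∫_K λ₀²`, `β = ∫_K λ₀λ₁`; with `α + 3β = 1/24` (part 21): **`α = 1/60 = |K|/10`, `β = 1/120 = |K|/20`**, transported to every reference
piece.  NOT a proof of H12⋆, NOT summit progress.  [folklore: P1 finite elements / Dirichlet's simplex integrals]
-/

noncomputable section

open Set Function Metric MeasureTheory Filter Topology
open scoped BigOperators NNReal ENNReal

namespace Summit.AtomisticToContinuum.Crystallization.Theorems.StrictSplittingRuleBirth

/-! ## The cube as the union of the six even pieces (integral form of part 8's tiling) -/

/-- The six even reference pieces cover exactly the unit cube. -/
theorem iUnion_p1RefCell_true : (⋃ π : Fin 6, p1RefCell true π) = Icc (0 : Fin 3 → ℝ) 1 := by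
  refine Subset.antisymm (fun p hp => ?_) (fun p hp => ?_)
  · obtain ⟨π, hπ⟩ := mem_iUnion.1 hp
    exact ⟨fun i => (p1RefCell_subset_cube hπ i).1, fun i => (p1RefCell_subset_cube hπ i).2⟩
  · obtain ⟨π, hπ⟩ := exists_p1RefCell true (p := p) fun i => ⟨hp.1 i, hp.2 i⟩
    exact mem_iUnion.2 ⟨π, hπ⟩

/-- **Cube integral = sum of the six piece integrals** (pieces overlap in null sets). -/
theorem setIntegral_cube_eq_sum_p1RefCell {f : (Fin 3 → ℝ) → ℝ} (hf : IntegrableOn f (Icc (0 : Fin 3 → ℝ) 1) volume) :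
    ∫ p in Icc (0 : Fin 3 → ℝ) 1, f p = ∑ π : Fin 6, ∫ p in p1RefCell true π, f p := by
  rw [← iUnion_p1RefCell_true, integral_iUnion_ae (fun π => (isClosed_p1RefCell true π).measurableSet.nullMeasurableSet)
    (fun π π' hne => volume_p1RefCell_inter true hne) (by rwa [iUnion_p1RefCell_true]), tsum_fintype]

/-! ## One honest integral: `∫_{[0,1]³} t² = 1/3` -/

/-- `∫_{[0,1]³} (p 0)² dp = 1/3` (product structure of Lebesgue measure). -/
theorem setIntegral_cube_coord_sq : ∫ p in Icc (0 : Fin 3 → ℝ) 1, p 0 ^ 2 = 1 / 3 := by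
  have hIcc : Icc (0 : Fin 3 → ℝ) 1 = Set.pi univ fun _ : Fin 3 => Icc (0 : ℝ) 1 := by
    rw [Set.pi_univ_Icc]; rfl
  rw [hIcc, volume_pi, Measure.restrict_pi_pi]
  have h := integral_fintype_prod_eq_prod (ι := Fin 3) (𝕜 := ℝ)
    (fun i : Fin 3 => if i = 0 then (fun x : ℝ => x ^ 2) else fun _ => 1) (μ := fun _ : Fin 3 => volume.restrict (Icc (0 : ℝ) 1))
  have hlhs : (fun x : Fin 3 → ℝ => ∏ i : Fin 3, (if i = 0 then (fun x : ℝ => x ^ 2) else fun _ => 1) (x i)) = fun x => x 0 ^ 2 := by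
    funext x
    simp [Fin.prod_univ_three]
  rw [hlhs] at h
  rw [h]
  have h0 : ∫ x in Icc (0 : ℝ) 1, x ^ 2 = 1 / 3 := by
    rw [integral_Icc_eq_integral_Ioc, ← intervalIntegral.integral_of_le zero_le_one, integral_pow]; norm_num
  have h1 : ∫ _ in Icc (0 : ℝ) 1, (1 : ℝ) = 1 := by
    rw [setIntegral_const, measureReal_def, Real.volume_Icc]; norm_num
  simp [Fin.prod_univ_three, h0, h1]

/-! ## Affine reproduction of the coordinate `t` on each even piece, pulled back to `K` -/

/-- On the corner simplex chart, the pull-back of the coordinate `t = q 0` of piece `π` under the reference map is the sum of the corner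
barycentric coordinates of those vertices of `π` whose `t`-offset is `1`:
`(p1RefMap true π p) 0 = Σ_m [p1VertOff true π m has t = 1]·λ_m(p)`. -/
theorem p1RefMap_coord_zero (π : Fin 6) (p : Fin 3 → ℝ) :
    p1RefMap true π p 0 = ∑ m : Fin 4, (((p1VertOff true π m).1 : ℤ) : ℝ) * p1Bary true 0 m p := by
  rw [p1RefMap_apply]
  fin_cases π <;> (simp [Fin.sum_univ_four, p1VertOff, p1Vec, p1Bary, p1BaryCoef]; try ring)

/-- The piece integral of `t²`, transported to `K`, is a quadratic form in the corner second moments. -/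
theorem setIntegral_p1RefCell_coord_sq (π : Fin 6) :
    ∫ q in p1RefCell true π, q 0 ^ 2 =
      ∑ m : Fin 4, ∑ m' : Fin 4, ((((p1VertOff true π m).1 : ℤ) : ℝ) * (((p1VertOff true π m').1 : ℤ) : ℝ)) *
        (∫ p in p1RefCell true 0, p1Bary true 0 m p * p1Bary true 0 m' p) := by
  have hK : IsCompact (p1RefCell true π) := by
    refine (isCompact_Icc (a := (0 : Fin 3 → ℝ)) (b := 1)).of_isClosed_subset (isClosed_p1RefCell true π) fun p hp => ?_
    exact ⟨fun i => (p1RefCell_subset_cube hp i).1, fun i => (p1RefCell_subset_cube hp i).2⟩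
  have hgi : IntegrableOn (fun q : Fin 3 → ℝ => q 0 ^ 2) (p1RefCell true π) volume :=
    (by fun_prop : Continuous fun q : Fin 3 → ℝ => q 0 ^ 2).continuousOn.integrableOn_compact hK
  rw [setIntegral_p1RefCell_transport true π (g := fun q : Fin 3 → ℝ => q 0 ^ 2)
    (g' := fun p => ∑ m : Fin 4, ∑ m' : Fin 4, ((((p1VertOff true π m).1 : ℤ) : ℝ) * (((p1VertOff true π m').1 : ℤ) : ℝ)) *
      (p1Bary true 0 m p * p1Bary true 0 m' p)) ?_ hgi]
  · rw [integral_finsetSum _ (fun m _ => ?_)]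
    · refine Finset.sum_congr rfl fun m _ => ?_
      rw [integral_finsetSum _ (fun m' _ => ?_)]
      · refine Finset.sum_congr rfl fun m' _ => ?_
        rw [integral_const_mul]
      · exact (integrableOn_p1Bary_mul true 0 m m' true 0).const_mul _
    · exact integrable_finsetSum _ fun m' _ => (integrableOn_p1Bary_mul true 0 m m' true 0).const_mul _
  · intro p
    simp only [p1RefMap_coord_zero, sq, Finset.sum_mul, Finset.mul_sum]
    refine Finset.sum_congr rfl fun m _ => Finset.sum_congr rfl fun m' _ => ?_
    ring

/-! ## Solving for the moments -/

/-- Diagonal corner moments are all `α = ∫_K λ₀²`, mixed ones all `β = ∫_K λ₀λ₁` (parts 21–22). -/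
theorem setIntegral_p1Bary_mul_corner_eq_ite (m m' : Fin 4) :
    (∫ p in p1RefCell true 0, p1Bary true 0 m p * p1Bary true 0 m' p) =
      if m = m' then ∫ p in p1RefCell true 0, p1Bary true 0 0 p * p1Bary true 0 0 p
      else ∫ p in p1RefCell true 0, p1Bary true 0 0 p * p1Bary true 0 1 p := by
  split_ifs with h
  · subst h; exact setIntegral_p1Bary_sq_eq m
  · exact setIntegral_p1Bary_offdiag_eq h

/-- **The cube relation**: `12α + 16β = 1/3`. -/
theorem setIntegral_p1Bary_cube_relation :
    12 * (∫ p in p1RefCell true 0, p1Bary true 0 0 p * p1Bary true 0 0 p) +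
      16 * (∫ p in p1RefCell true 0, p1Bary true 0 0 p * p1Bary true 0 1 p) = 1 / 3 := by
  set α := ∫ p in p1RefCell true 0, p1Bary true 0 0 p * p1Bary true 0 0 p with hα
  set β := ∫ p in p1RefCell true 0, p1Bary true 0 0 p * p1Bary true 0 1 p with hβ
  have key : ∀ m m' : Fin 4, (∫ p in p1RefCell true 0, p1Bary true 0 m p * p1Bary true 0 m' p) = if m = m' then α else β :=
    fun m m' => by rw [hα, hβ]; exact setIntegral_p1Bary_mul_corner_eq_ite m m'
  have hf : IntegrableOn (fun q : Fin 3 → ℝ => q 0 ^ 2) (Icc (0 : Fin 3 → ℝ) 1) volume :=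
    (by fun_prop : Continuous fun q : Fin 3 → ℝ => q 0 ^ 2).continuousOn.integrableOn_compact isCompact_Icc
  have h := setIntegral_cube_eq_sum_p1RefCell hf
  rw [setIntegral_cube_coord_sq] at h
  simp only [setIntegral_p1RefCell_coord_sq, key] at h
  simp [Fin.sum_univ_succ, p1VertOff] at h
  linarith

/-- **Exact diagonal second moment of the corner simplex: `∫_K λ_m² = 1/60 = |K|/10`.**  NOT a proof of H12⋆, NOT summit progress. -/
theorem setIntegral_p1Bary_sq_corner (m : Fin 4) :
    ∫ p in p1RefCell true 0, p1Bary true 0 m p * p1Bary true 0 m p = 1 / 60 := by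
  rw [setIntegral_p1Bary_sq_eq m]
  linarith [setIntegral_p1Bary_cube_relation, setIntegral_p1Bary_sq_add]

/-- **Exact mixed second moment of the corner simplex: `∫_K λ_mλ_{m'} = 1/120 = |K|/20`** (`m ≠ m'`).  NOT a proof of H12⋆, NOT summit
progress. -/
theorem setIntegral_p1Bary_mul_corner {m m' : Fin 4} (hne : m ≠ m') :
    ∫ p in p1RefCell true 0, p1Bary true 0 m p * p1Bary true 0 m' p = 1 / 120 := by
  rw [setIntegral_p1Bary_offdiag_eq hne]
  linarith [setIntegral_p1Bary_cube_relation, setIntegral_p1Bary_sq_add]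

/-- **Exact second moments of every reference piece**: `∫_{piece} λ_mλ_{m'} = 1/60` if `m = m'`, `1/120` otherwise. -/
theorem setIntegral_p1Bary_mul_p1RefCell (e : Bool) (π : Fin 6) (m m' : Fin 4) :
    ∫ q in p1RefCell e π, p1Bary e π m q * p1Bary e π m' q = if m = m' then 1 / 60 else 1 / 120 := by
  rw [setIntegral_p1RefCell_transport e π (g := fun q => p1Bary e π m q * p1Bary e π m' q) (g' := fun p => p1Bary true 0 m p * p1Bary true 0 m' p)
    (fun p => by simp only [p1Bary_p1RefMap]) (integrableOn_p1Bary_mul e π m m' e π)]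
  split_ifs with h
  · subst h; exact setIntegral_p1Bary_sq_corner m
  · exact setIntegral_p1Bary_mul_corner h

/-- **Second moment of a piece against an arbitrary vertex function**: for values `f : Fin 4 → ℝ`,
`∫_{piece} (Σ_m f_m λ_m)·λ_{m₀} = (1/120)·(Σ_m f_m + f_{m₀})` — the form in which the first moment of a hat function is read off
(`f_m` = a coordinate of vertex `m` minus that of vertex `m₀`). -/
theorem setIntegral_p1Bary_lin_mul_p1RefCell (e : Bool) (π : Fin 6) (f : Fin 4 → ℝ) (m₀ : Fin 4) :
    ∫ q in p1RefCell e π, (∑ m : Fin 4, f m * p1Bary e π m q) * p1Bary e π m₀ q = (1 / 120) * ((∑ m : Fin 4, f m) + f m₀) := by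
  have hsplit : (fun q => (∑ m : Fin 4, f m * p1Bary e π m q) * p1Bary e π m₀ q) =
      fun q => ∑ m : Fin 4, f m * (p1Bary e π m q * p1Bary e π m₀ q) := by
    funext q; rw [Finset.sum_mul]; refine Finset.sum_congr rfl fun m _ => ?_; ring
  rw [hsplit, integral_finsetSum _ (fun m _ => (integrableOn_p1Bary_mul e π m m₀ e π).const_mul _)]
  simp only [integral_const_mul, setIntegral_p1Bary_mul_p1RefCell]
  simp only [Fin.sum_univ_four]
  fin_cases m₀ <;> simp <;> ring

end Summit.AtomisticToContinuum.Crystallization.Theorems.StrictSplittingRuleBirth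

end
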